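import Literature.NumberTheory.PAdicHodge.KummerFilZeroCoboundaryRationalPoints
import HarnessLib

/-!
# K1 for EVERY rational point of the K★ / TDS57 cell curves over `F = ℚ_p(ϖ)` (good supersingular `𝒪_D`-models, `p ∈ {5, 7}`)

Topic `Literature/NumberTheory/PAdicHodge`; namespace `Literature.NumberTheory.PAdicHodge.AinfTop`. THEOREMS ONLY (no definition, no
named fact, no instance, no `sorry`). The `𝒪_D`-currency twin of `KummerFilZeroCoboundaryRationalPoints` (`ℤ`-models over `ℚ_p`): the point
data of ★★★ `isFilZeroCoboundary_kummerO_explicitModel_of_nsmul_of_coeffDisc` (`KummerCocycleMatchingORational`: a multiple `m • Q₀ ∈ E₁`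
with `𝒪_D`-rational parameter) are DISCHARGED for every `F`-rational point when the `w`-integers of `F` come from `𝒪_D = ℤ_p[ϖ]`
(`F = ℚ_p(ϖ)`, Serre I §6 Prop. 17), by the tree's index theorem `FormalGroupChart.exists_nsmul_mem_level_of_isNonarchimedeanLocalField`
and the dictionary `E(F) → E(F̄) → E(ℂ_F)` for `𝒪_F`-models:

* `norm_algebraMap_lt_one_of_val_lt_one`, `one_lt_valuation_algebraMap_of_one_lt_val` — `F → ℂ_F` against a compatible valuation `w`;
* `isIntegral_curveFO` — `W♭ ⊗ F` is `w`-integral; `zCoord_geomToCO_toGeomPoints`, `geomToCO_toGeomPoints_mem_kernel`, `exists_divSeqO`;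
* ★★★★ **`isFilZeroCoboundary_kummerO_explicitModel_of_rational`** — for the explicit good supersingular `𝒪_D`-models `W_D ⊗_ψ 𝒪_F` of the
  cells (`D = (X^e − p, ϖ)`, `p ∈ {5,7}`, (N1′) inequalities) over a `p`-adic field `F` with `{w ≤ 1} ⊆ 𝒪_D` and EVERY `P ∈ E(F)`, EVERY
  `p`-power division sequence `Q` of `P` in `E(F̄)`: `σ ↦ 1 ⊗ (σQₙ − Qₙ)ₙ` is a `Fil⁰`-coboundary of `B_dR(F) ⊗ V_pE` — no period, matching,
  lift or point hypothesis left.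

Crux K★ `stmt-BirchSwinnertonDyer-22226`, hT₂/K3 programme brick K1 at the cells. BSD / K★ are not proved by any of this.

## References
* [BlochKato1990] S. Bloch, K. Kato (1990), Ex. 3.10.1, Example 3.11 (3.11.1).
* [SilvermanAEC2009] J. H. Silverman, *AEC* (2009), Prop. VII.2.1–VII.2.2, VII.6 Cor. 6.2 / Ex. 7.6, III.4.2(a), IV.7.5.
* [SerreLocalFields1979] J.-P. Serre, *Local Fields* (1979), Ch. I §6 Prop. 17–18.
-/

noncomputable section

open scoped TensorProduct Classical NNReal

namespace Literature.NumberTheory.PAdicHodge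

open Literature Literature.NumberTheory.GaloisRepresentations Literature.NumberTheory.EllipticCurves WeierstrassCurve
open Literature.NumberTheory.GaloisRepresentations.IsNonarchimedeanLocalField Field ValuativeRel
open Literature.NumberTheory.GaloisRepresentations.LubinTate Literature.NumberTheory.EllipticCurves.FormalGroupChart

namespace AinfTop

section Dictionary

variable {F : Type} [Field F] [ValuativeRel F] [TopologicalSpace F] [IsNonarchimedeanLocalField F]

/-- `w x < 1 ⇒ ‖x‖_{ℂ_F} < 1` for a valuation `w` compatible with the valuative structure of `F`. [cite: SerreLocalFields1979, Ch. II §1] -/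
theorem norm_algebraMap_lt_one_of_val_lt_one (w : Valuation F ℝ≥0) [w.Compatible] {x : F} (hx : w x < 1) :
    ‖algebraMap F (CompletedAlgClosure F) x‖ < 1 := by
  have hx' : ¬ (1 : F) ≤ᵥ x := fun hle => by
    rw [Valuation.Compatible.vle_iff_le (v := w), map_one] at hle
    exact not_le.2 hx hle
  have hn := (norm_lt_norm_iff_not_vle (K := F) x 1).2 hx'
  letI := nontriviallyNormedField F
  have h1 : ‖(1 : F)‖ = 1 := norm_one
  rw [CompletedAlgClosure.norm_algebraMap, ← h1]
  exact hn

/-- `1 < w x ⇒ 1 < ‖x‖_{ℂ_F}` (as `NormedField.valuation`) for a compatible valuation `w`. [cite: SerreLocalFields1979, Ch. II §1] -/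
theorem one_lt_valuation_algebraMap_of_one_lt_val (w : Valuation F ℝ≥0) [w.Compatible] {x : F} (hx : 1 < w x) :
    1 < NormedField.valuation (K := CompletedAlgClosure F) (algebraMap F (CompletedAlgClosure F) x) := by
  have hx' : ¬ x ≤ᵥ (1 : F) := fun hle => by
    rw [Valuation.Compatible.vle_iff_le (v := w), map_one] at hle
    exact not_lt.2 hle hx
  have hn := (norm_lt_norm_iff_not_vle (K := F) 1 x).2 hx'
  letI := nontriviallyNormedField F
  have h1 : ‖(1 : F)‖ = 1 := norm_one
  have hn' : (1 : ℝ) < ‖x‖ := by rw [← h1]; exact hn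
  rw [NormedField.valuation_apply, ← NNReal.coe_lt_coe, NNReal.coe_one, coe_nnnorm, CompletedAlgClosure.norm_algebraMap]
  exact hn'

variable (W : WeierstrassCurve (LTCoeff F)) {p : ℕ}

omit [TopologicalSpace F] [IsNonarchimedeanLocalField F] in
/-- **`W♭ ⊗ F` is `w`-integral** for every compatible valuation `w` (`W♭` has coefficients in `𝒪_F`). [cite: SilvermanAEC2009, VII.§1] -/
theorem isIntegral_curveFO (w : Valuation F ℝ≥0) [w.Compatible] : (curveFO F W).IsIntegral w.integer := by
  have hwv : w.IsEquiv (valuation F) := ValuativeRel.isEquiv w (valuation F)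
  have hmem : ∀ a : LTCoeff F, algebraMap (LTCoeff F) F a ∈ w.integer := fun a =>
    (Valuation.mem_integer_iff _ _).mpr (hwv.le_one_iff_le_one.mpr ((Valuation.mem_integer_iff _ _).mp ((LTCoeff.of F).symm a).2))
  exact WeierstrassCurve.isIntegral_of_exists_lift _ ⟨⟨_, hmem W.a₁⟩, rfl⟩ ⟨⟨_, hmem W.a₂⟩, rfl⟩ ⟨⟨_, hmem W.a₃⟩, rfl⟩
    ⟨⟨_, hmem W.a₄⟩, rfl⟩ ⟨⟨_, hmem W.a₆⟩, rfl⟩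

omit [TopologicalSpace F] [IsNonarchimedeanLocalField F] in
/-- The geometric point of a rational affine point, with its coordinates (`𝒪_F`-models). [cite: SilvermanAEC2009, VIII.§1] -/
theorem toGeomPoints_curveFO_some {x y : F} (h : (curveFO F W).toAffine.Nonsingular x y) :
    ∃ h', WeierstrassCurve.toGeomPoints (curveFO F W) (.some x y h) =
      (.some (algebraMap F (AlgebraicClosure F) x) (algebraMap F (AlgebraicClosure F) y) h' : (curveFO F W).geomPoints) :=
  ⟨(WeierstrassCurve.Affine.map_nonsingular _ (algebraMap F (AlgebraicClosure F)).injective x y).mpr h, rfl⟩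

/-- **`E(F) → E(F̄) → E(ℂ_F)` preserves the parameter** (`𝒪_F`-models). [cite: SilvermanAEC2009, Prop. VII.2.2] -/
theorem zCoord_geomToCO_toGeomPoints (P : (curveFO F W).toAffine.Point) :
    (geomToCO W (WeierstrassCurve.toGeomPoints (curveFO F W) P)).zCoord = algebraMap F (CompletedAlgClosure F) P.zCoord := by
  rcases P with _ | ⟨x, y, h⟩
  · rw [← WeierstrassCurve.Affine.Point.zero_def, map_zero, map_zero, WeierstrassCurve.Affine.Point.zCoord_zero,
      WeierstrassCurve.Affine.Point.zCoord_zero, map_zero]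
  · obtain ⟨h₁, e₁⟩ := toGeomPoints_curveFO_some W h
    obtain ⟨h₂, e₂⟩ := geomToCO_some W h₁
    rw [e₁, e₂, WeierstrassCurve.Affine.Point.zCoord_some, WeierstrassCurve.Affine.Point.zCoord_some, algClosureToC_algebraMap,
      algClosureToC_algebraMap, map_div₀, map_neg]

/-- **`E(F) → E(F̄) → E(ℂ_F)` preserves the kernel of reduction** (`𝒪_F`-models, compatible `w`). [cite: SilvermanAEC2009, Prop. VII.2.1–VII.2.2] -/
theorem geomToCO_toGeomPoints_mem_kernel (w : Valuation F ℝ≥0) [w.Compatible] [(curveFO F W).IsIntegral w.integer]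
    {P : (curveFO F W).toAffine.Point} (hP : P ∈ kernel w (curveFO F W)) :
    geomToCO W (WeierstrassCurve.toGeomPoints (curveFO F W) P) ∈
      kernel (NormedField.valuation (K := CompletedAlgClosure F)) (curveOver (CompletedAlgClosure F) W) := by
  rcases P with _ | ⟨x, y, h⟩
  · rw [← WeierstrassCurve.Affine.Point.zero_def, map_zero, map_zero]
    exact (kernel (NormedField.valuation (K := CompletedAlgClosure F)) (curveOver (CompletedAlgClosure F) W)).zero_mem
  · obtain ⟨h₁, e₁⟩ := toGeomPoints_curveFO_some W h
    obtain ⟨h₂, e₂⟩ := geomToCO_some W h₁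
    rw [e₁, e₂]
    refine (some_mem_kernel_iff h₂).mpr ?_
    rw [some_mem_kernel_iff h] at hP
    change 1 < NormedField.valuation (K := CompletedAlgClosure F) (algClosureToC F (algebraMap F (AlgebraicClosure F) x))
    rw [algClosureToC_algebraMap]
    exact one_lt_valuation_algebraMap_of_one_lt_val w hP

omit [TopologicalSpace F] [IsNonarchimedeanLocalField F] in
/-- **Division sequences exist** in `E(F̄)` (`𝒪_F`-models). [cite: SilvermanAEC2009, Prop. III.4.2(a) and VIII.§2] -/
theorem exists_divSeqO [Fact p.Prime] [(curveFO F W).IsElliptic] (P : (curveFO F W).geomPoints) :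
    ∃ Q : ℕ → (curveFO F W).geomPoints, Q 0 = P ∧ ∀ n, p • Q (n + 1) = Q n := by
  have hsurj : ∀ R : (curveFO F W).geomPoints, ∃ S : (curveFO F W).geomPoints, p • S = R := fun R =>
    ((curveFO F W).baseChange (AlgebraicClosure F)).nsmul_surjective_of_isAlgClosed (Fact.out : p.Prime).ne_zero R
  choose f hf using hsurj
  exact ⟨fun n => Nat.rec P (fun _ R => f R) n, rfl, fun n => hf _⟩

omit [TopologicalSpace F] [IsNonarchimedeanLocalField F] in
/-- `Q₀ = ι(P)` is `Γ_F`-fixed (`𝒪_F`-models). [cite: SilvermanAEC2009, VIII.§1] -/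
theorem smul_divSeqO_zero_of_eq_toGeomPoints (P : (curveFO F W).toAffine.Point) {Q : ℕ → (curveFO F W).geomPoints}
    (hQ0 : Q 0 = WeierstrassCurve.toGeomPoints (curveFO F W) P) (σ : absoluteGaloisGroup F) : σ • Q 0 = Q 0 := by
  rw [hQ0]; exact WeierstrassCurve.smul_toGeomPoints _ σ P

end Dictionary

/-! ## The cells: every rational point -/

section Cells

variable {F : Type} [Field F] [ValuativeRel F] [TopologicalSpace F] [IsNonarchimedeanLocalField F] [CharZero F]
  {p : ℕ} [Fact p.Prime] [Fact (¬ IsUnit (p : integerC F))] [IsAdicComplete (Ideal.span {(p : integerC F)}) (integerC F)]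
  (hp : valuation F p < 1) [Algebra ℚ_[p] F]

/-- ★★★★ **K1 for EVERY rational point of the explicit good supersingular `𝒪_D`-models of the K★ / TDS57 cells over `F = ℚ_p(ϖ)`.**
`D = (X^e − p, ϖ)` an Eisenstein datum of the `p`-adic field `F` (`p ∈ {5, 7}`) whose `w`-integers come from `𝒪_D = ℤ_p[ϖ]` (`hOF`; i.e.
`F = ℚ_p(ϖ)`, Serre I §6 Prop. 17), `W_D = ⟨0, 0, 0, a ϱ^{r₄}, b ϱ^{r₆}⟩` under the cell hypotheses of
`isFilZeroCoboundary_kummerO_explicitModel_of_nsmul_of_coeffDisc`, `E = curveFO F (W_D ⊗_ψ 𝒪_F)`, `P ∈ E(F)` ANY point and `Q` ANY `p`-power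
division sequence of `P` in `E(F̄)`: the algebraic Kummer cocycle `σ ↦ 1 ⊗ (σQₙ − Qₙ)ₙ` is a `Fil⁰`-coboundary of `B_dR(F) ⊗ V_pE`. Proof:
`m • P ∈ E⁽ᵖ⁾(F) ⊆ E₁(F)` for some `m ≥ 1` (`exists_nsmul_mem_level_of_isNonarchimedeanLocalField`), its parameter is `c ∈ 𝔪_D`, and ★★★
applies through the dictionary `E(F) → E(F̄) → E(ℂ_F)`.
[cite: BlochKato1990, Ex. 3.10.1, Example 3.11 (3.11.1)] [cite: SilvermanAEC2009, Prop. VII.2.1–VII.2.2, VII.6 Cor. 6.2 and Ex. 7.6, IV.7.5] -/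
theorem isFilZeroCoboundary_kummerO_explicitModel_of_rational (D : EisensteinRoot F p hp) {e : ℕ}
    (hD : D.poly = Polynomial.X ^ e - Polynomial.C (p : ℤ_[p])) (a b : ℤ_[p]) (r₄ r₆ t₄ t₆ : ℕ) (hp57 : p = 5 ∨ p = 7)
    (h5 : p = 5 → 0 < r₄ ∧ e < 9 ∧ e < r₄ + 4) (h7 : p = 7 → 0 < r₆ ∧ e < 13 ∧ e < r₆ + 6)
    (h₄ : 3 * r₄ = e * t₄) (h₆ : 2 * r₆ = e * t₆) (hu : IsUnit (64 * a ^ 3 * (p : ℤ_[p]) ^ t₄ + 432 * b ^ 2 * (p : ℤ_[p]) ^ t₆))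
    (ψ : EisensteinRoot.CoeffDisc D →+* LTCoeff F) (hψ : ∀ c, algebraMap (LTCoeff F) F (ψ c) = EisensteinRoot.CoeffDisc.toF D c)
    [(curveFO F ((((⟨0, 0, 0, AdjoinRoot.of D.poly a * AdjoinRoot.root D.poly ^ r₄,
      AdjoinRoot.of D.poly b * AdjoinRoot.root D.poly ^ r₆⟩ : WeierstrassCurve D.Coeff).map
      (EisensteinRoot.CoeffDisc.of D).toRingHom)).map ψ)).IsElliptic]
    [(curveOver (CompletedAlgClosure F) ((((⟨0, 0, 0, AdjoinRoot.of D.poly a * AdjoinRoot.root D.poly ^ r₄,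
      AdjoinRoot.of D.poly b * AdjoinRoot.root D.poly ^ r₆⟩ : WeierstrassCurve D.Coeff).map
      (EisensteinRoot.CoeffDisc.of D).toRingHom)).map ψ)).IsElliptic]
    (w : Valuation F ℝ≥0) [w.Compatible] (hOF : ∀ x : F, w x ≤ 1 → ∃ c : EisensteinRoot.CoeffDisc D, EisensteinRoot.CoeffDisc.toF D c = x)
    (P : (curveFO F ((((⟨0, 0, 0, AdjoinRoot.of D.poly a * AdjoinRoot.root D.poly ^ r₄,
      AdjoinRoot.of D.poly b * AdjoinRoot.root D.poly ^ r₆⟩ : WeierstrassCurve D.Coeff).map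
      (EisensteinRoot.CoeffDisc.of D).toRingHom)).map ψ)).toAffine.Point)
    {Q : ℕ → (curveFO F ((((⟨0, 0, 0, AdjoinRoot.of D.poly a * AdjoinRoot.root D.poly ^ r₄,
      AdjoinRoot.of D.poly b * AdjoinRoot.root D.poly ^ r₆⟩ : WeierstrassCurve D.Coeff).map
      (EisensteinRoot.CoeffDisc.of D).toRingHom)).map ψ)).geomPoints}
    (hQ : ∀ n, p • Q (n + 1) = Q n) (hQ0 : Q 0 = WeierstrassCurve.toGeomPoints _ P)
    (hfix : ∀ σ : absoluteGaloisGroup F, σ • Q 0 = Q 0) :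
    (bdRPeriodRingData (F := F) (p := p) hp).IsFilZeroCoboundary
      (rationalTateRep (curveFO F ((((⟨0, 0, 0, AdjoinRoot.of D.poly a * AdjoinRoot.root D.poly ^ r₄,
        AdjoinRoot.of D.poly b * AdjoinRoot.root D.poly ^ r₆⟩ : WeierstrassCurve D.Coeff).map
        (EisensteinRoot.CoeffDisc.of D).toRingHom)).map ψ)) p) fun σ =>
      ((1 : (bdRPeriodRingData (F := F) (p := p) hp).B) ⊗ₜ[ℚ_[p]]
        TateModule.toRational p (TateModule.mk (fun n => σ • Q n - Q n)
          (pow_smul_kummerO_eq_zero (hp := hp) _ ψ hQ hfix σ) (smul_kummerO_succ (hp := hp) _ ψ hQ σ)) :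
        (bdRPeriodRingData (F := F) (p := p) hp).B ⊗[ℚ_[p]] (curveFO F ((((⟨0, 0, 0, AdjoinRoot.of D.poly a * AdjoinRoot.root D.poly ^ r₄,
          AdjoinRoot.of D.poly b * AdjoinRoot.root D.poly ^ r₆⟩ : WeierstrassCurve D.Coeff).map
          (EisensteinRoot.CoeffDisc.of D).toRingHom)).map ψ)).rationalTateModule p) := by
  haveI := isIntegral_curveFO ((((⟨0, 0, 0, AdjoinRoot.of D.poly a * AdjoinRoot.root D.poly ^ r₄,
      AdjoinRoot.of D.poly b * AdjoinRoot.root D.poly ^ r₆⟩ : WeierstrassCurve D.Coeff).map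
      (EisensteinRoot.CoeffDisc.of D).toRingHom)).map ψ) w
  have hp0 : (p : F) ≠ 0 := Nat.cast_ne_zero.2 (Fact.out : p.Prime).ne_zero
  obtain ⟨m, hm, hlev⟩ := FormalGroupChart.exists_nsmul_mem_level_of_isNonarchimedeanLocalField (curveFO F _) w hp0 P
  obtain ⟨hker, -⟩ := FormalGroupChart.mem_level_iff.1 hlev
  have hz1 : w (m • P).zCoord < 1 := val_zCoord_lt_one hker
  obtain ⟨c, hc⟩ := hOF _ hz1.le
  have hmQ : m • Q 0 = WeierstrassCurve.toGeomPoints _ (m • P) := by rw [hQ0, map_nsmul]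
  refine isFilZeroCoboundary_kummerO_explicitModel_of_nsmul_of_coeffDisc hp D hD a b r₄ r₆ t₄ t₆ hp57 h5 h7 h₄ h₆ hu ψ hψ hQ hfix hm.ne'
    ?_ c ?_ ?_
  · rw [hmQ]; exact geomToCO_toGeomPoints_mem_kernel _ w hker
  · rw [hc]; exact norm_algebraMap_lt_one_of_val_lt_one w hz1
  · rw [hmQ, zCoord_geomToCO_toGeomPoints, hc]

end Cells

end AinfTop

end Literature.NumberTheory.PAdicHodge

end
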